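import Literature.NumberTheory.EllipticCurves.Kobayashi2003.EtaColemanInterpolationCoherent
import Literature.NumberTheory.EllipticCurves.Kato2004.AdmissibleZetaClassNonvanishingProofs
import Mathlib.RingTheory.RootsOfUnity.Complex
import Mathlib.Algebra.Module.Torsion.Field
import Mathlib.RingTheory.Flat.Basic
import HarnessLib

/-!
# Kato 2004 / Kobayashi 2003: FRAME-OFFSET DESCENT — the offsets between a TRACE-coherent root system and the
# `ι`-standard root system of a Kato zeta datum are TAME beyond a level `n₁` (THEOREMS ONLY; kernel glue «W2» of
# the `kato_perrin_riou_istar` 2c-T1 re-typing docket (T3), cell `bsd-cm`, seat `bsd-cm-k-ty1` g40)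

Topic `NumberTheory/EllipticCurves`, sub-directory `Kato2004` (namespace = path, grouping sub-namespace
`FrameOffsetDescent`). THEOREMS ONLY (net debt 0): no `def … : Prop`, no named fact, no instance, no notation, no
`sorry`. Imports: Literature + Mathlib only.

## What is proved

Write `m(k) = cycLevel p k ∅ = p^k`, `F_k = CyclotomicField m(k) ℚ`, `σ_b = EulerSystemValues.sigma`. For a value datum
`Λ` and a root system `μ = (μ_n ∈ F_{n+1})` that is TRACE-COHERENT with `Λ`
(`Kato2004.IsTraceCoherentRootSystem W p Λ μ`, the [C-align] predicate: `exp* ∘ cor = (1 ⊗ Tr_{j_n}) ∘ exp*` along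
`j_n(μ_n) = μ_{n+1}^p`), a family of complex embeddings `ι_m : ℚ(ζ_m) → ℂ` and its `ι`-STANDARD root system
`ρ = (ρ_n)`, `ι_{m(n+1)}(ρ_n) = exp(2πi/p^{n+1})` (§1: it exists), and the OFFSETS `o_n ∈ (ℤ/p^{n+1})ˣ`,
`μ_n = ρ_n^{o_n}` (§1: they exist):

* §1–§3 (frames): `ι`-standard roots exist; `p`-adic embeddings coherent on ANY primitive root system exist
  (`Kobayashi2003.IsCoherentPadicEmbeddings`, Kobayashi §8.4); re-framing `ιp ↦ ιp ∘ σ_a` multiplies Kobayashi's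
  `p`-adic character sum by `θ(a⁻¹)` and moves the Gauss sum to the root `ζ^a` (Kobayashi Prop. 8.25/8.26 read in two
  frames); a family twisted level-wise by `σ_{o_n⁻¹}` is coherent on `μ` when the original is coherent on `ρ`.
* §4–§5 (THE DESCENT, `exists_forall_offset_pow_sub_one_eq_one`): if moreover `Λ` carries a Kato zeta family
  (`Kato2004.ZetaBody W p f ι κK Λ c d a A z x`: Euler-system norm relations (C1) [Prop. 8.12], rationality (C4)
  [Thm. 9.7] and the value law (C5) [Thm. 9.7 ∘ Thm. 6.6 (1)] IN THE FRAME `ι`) for the newform `f` of `W` with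
  `κK ≠ 0`, Kato's guards `(c, 6pA) = 1`, `(d, 6pN) = 1`, `dd′ ≡ 1 (A)`, `R⁻_𝟙 ≠ 0`, and Rohrlich's finiteness holds for
  `f` (hypothesis `hR`, the shape of `IsAdmissibleZetaClass.ne_zero_of_rohrlich`), then there is `n₁` with
  `(π(o_{n+1}) · o_n⁻¹)^{p−1} = 1` for all `n ≥ n₁` — the cross-level offset is TAME — and consequently
  `π(o_{n+1}^{p^{n+1}−1}) = o_n^{pⁿ−1}` (`exists_forall_unitsMap_pow_eq_pow`): the wild parts `(o_n^{1−pⁿ})_{n ≥ n₁}` form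
  ONE element of `ℤ_pˣ`.  Mechanism: (D1) `ι_{n+2} ∘ j_n = ι_{n+1} ∘ σ_t`; (D2) TRACE + (C1) + (C4) + injectivity of
  `x ↦ 1 ⊗ x` give `j_n(x_{n+1}) = Σ_{c ≡ 1 (p^{n+1})} σ_c x_{n+2}`; (D3) hence
  `charSum_{n+2}(χ∘π, x_{n+2}) = χ(t)⁻¹ · charSum_{n+1}(χ, x_{n+1})`, while (C5) evaluates both sides by THE SAME depleted
  `L`-value and cusp factor, so `κK · L(1)/Ω⁺ · R⁻_χ̄ · (χ(t)⁻¹ − 1) = 0`; (D4) for the LAYER character `χ` of level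
  `p^{n+1}` (kernel `{b^{p−1} = 1}`, `LayerCharacter.exists_layerCharacter_cuspFactor_ne_zero`) Shimura's continuation,
  Rohrlich's bound and the Euler factors at `s = 1` (`exists_continuation_changeLevel_of`) make the three factors
  non-zero beyond `n₁`, so `χ(t) = 1`, i.e. `t` is tame; (D5) `t = π(o_{n+1})·o_n⁻¹` because `exp(2πi/p^{n+2})^p =
  exp(2πi/p^{n+1})`.  In print this is the remark that Kato's `ζ_{p^n} = exp(2πi/p^n) ∈ ℂ` (§4.2, fixed `ℚ̄ ⊂ ℂ`) IS
  norm-coherent, so that the root system of [C-align] may be taken `ι`-standard up to `ℤ_pˣ` — read here through the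
  value law only (the kernel cannot see Kato's `ℚ̄`), whence the qualifier «beyond `n₁`».

HONEST LABELS: theorems about frames and offsets; no statement about BSD, Col⁺, or 2c-T1 by itself; 19223 OPEN; BSD is
proved for no curve. References: [Kato2004Asterisque] §4.2 (p. 143), (5.7.1) (p. 157), Thm. 6.6 (1) (p. 163), Prop. 8.12
(p. 186), §9.4 (p. 188), Thm. 9.7 (p. 189), Thm. 12.5 (1) and proof (pp. 221–222), Ex. 13.3 (p. 225);
[Kobayashi2003] §8.4 (p. 16), Prop. 8.25–8.26 (pp. 24–25); [RohrlichInventiones1984] Theorem (p. 409);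
[Washington1997] §13.1; [Shimura1971] Thm. 3.66.
-/

set_option autoImplicit false
set_option backward.isDefEq.respectTransparency false

noncomputable section

open scoped BigOperators NumberField TensorProduct
open Field CongruenceSubgroup Polynomial IsDedekindDomain
open Literature.NumberTheory.GaloisRepresentations
open Literature.NumberTheory.EllipticCurves Literature.NumberTheory.EllipticCurves.ModularForms
open Literature.NumberTheory.EllipticCurves.Kato2004.EulerSystemValues
open Literature.NumberTheory.EllipticCurves.Kobayashi2003

namespace Literature.NumberTheory.EllipticCurves.Kato2004

namespace FrameOffsetDescent

variable {p : ℕ} [hp : Fact p.Prime]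

/-! ## §0 Plumbing (private): the levels `m(k) = p^k`, gluing level-indexed families, `1 ⊗ (·)` is injective -/

omit hp in
/-- `m(k, ∅) = p^k`. [folklore] -/
private theorem cycLevel_empty (k : ℕ) : cycLevel p k ∅ = p ^ k := by
  simp [cycLevel]

omit hp in
/-- `m(n+2, ∅) = p · m(n+1, ∅)`. [folklore] -/
private theorem cycLevel_succ_succ (n : ℕ) : cycLevel p (n + 2) ∅ = p * cycLevel p (n + 1) ∅ := by
  rw [cycLevel_empty, cycLevel_empty, pow_succ, mul_comm]

/-- `k ↦ m(k+1, ∅)` is injective. [folklore] -/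
private theorem level_injective {k n : ℕ} (h : cycLevel p (k + 1) ∅ = cycLevel p (n + 1) ∅) : k = n := by
  rw [cycLevel_empty, cycLevel_empty] at h
  have := Nat.pow_right_injective hp.out.two_le h
  omega

/-- Gluing a family indexed by the pure `p`-power levels into one indexed by all `m`. [folklore] -/
private theorem exists_family_eq {X : ℕ → Type} (d : ∀ m, X m) (g : ∀ n : ℕ, X (cycLevel p (n + 1) ∅)) :
    ∃ G : ∀ m, X m, ∀ n, G (cycLevel p (n + 1) ∅) = g n := by
  classical
  refine ⟨fun m => if h : ∃ n, cycLevel p (n + 1) ∅ = m then cast (congrArg X h.choose_spec) (g h.choose)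
    else d m, fun n => ?_⟩
  have h : ∃ k, cycLevel p (k + 1) ∅ = cycLevel p (n + 1) ∅ := ⟨n, rfl⟩
  dsimp only
  rw [dif_pos h]
  have key : ∀ (k : ℕ) (e : cycLevel p (k + 1) ∅ = cycLevel p (n + 1) ∅),
      cast (congrArg X e) (g k) = g n := by
    intro k e
    obtain rfl := level_injective e
    rfl
  exact key h.choose h.choose_spec

/-- An embedding `ℚ(ζ_m) → ℂ_p`. [folklore] -/
private theorem nonempty_algHom_padicComplex (m : ℕ) [NeZero m] :
    Nonempty (CyclotomicField m ℚ →ₐ[ℚ] ℂ_[p]) := by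
  haveI : Algebra.IsAlgebraic ℚ (CyclotomicField m ℚ) := Algebra.IsAlgebraic.of_finite ℚ _
  haveI : Module.IsTorsionFree ℚ ℂ_[p] := DivisionSemiring.to_moduleIsTorsionFree
  exact ⟨IsAlgClosed.lift⟩

/-- `x ↦ 1 ⊗ x : F → ℚ_p ⊗_ℚ F` is injective (`F` is flat over the field `ℚ`). [folklore] -/
private theorem tmul_right_injective (F : Type) [AddCommGroup F] [Module ℚ F] :
    Function.Injective (fun x : F => (1 : ℚ_[p]) ⊗ₜ[ℚ] x) := by
  have h1 : Function.Injective ((Algebra.linearMap ℚ ℚ_[p]).rTensor F) :=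
    Module.Flat.rTensor_preserves_injective_linearMap _ (algebraMap ℚ ℚ_[p]).injective
  have h2 : Function.Injective (TensorProduct.lid ℚ F).symm := (TensorProduct.lid ℚ F).symm.injective
  have h3 : (fun x : F => (1 : ℚ_[p]) ⊗ₜ[ℚ] x) =
      (Algebra.linearMap ℚ ℚ_[p]).rTensor F ∘ (TensorProduct.lid ℚ F).symm := by
    funext x
    simp [LinearMap.rTensor_tmul]
  rw [h3]
  exact h1.comp h2

/-- `ζ^{a·a⁻¹} = ζ` for an `m`-th root of unity and `a ∈ (ℤ/m)ˣ`. [folklore] -/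
private theorem pow_val_pow_val_inv {M : Type} [Monoid M] {m : ℕ} [NeZero m] {ζ : M} (hζ : ζ ^ m = 1)
    (a : (ZMod m)ˣ) : (ζ ^ (a : ZMod m).val) ^ ((a⁻¹ : (ZMod m)ˣ) : ZMod m).val = ζ := by
  rw [← pow_mul]
  have h : ((a : ZMod m).val * ((a⁻¹ : (ZMod m)ˣ) : ZMod m).val) % m = 1 % m := by
    rw [← ZMod.val_mul, ← Units.val_mul, mul_inv_cancel, Units.val_one, ZMod.val_one_eq_one_mod]
  rw [← Nat.mod_add_div ((a : ZMod m).val * ((a⁻¹ : (ZMod m)ˣ) : ZMod m).val) m, pow_add, pow_mul, hζ, one_pow,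
    mul_one, h]
  rcases eq_or_ne m 1 with rfl | hm
  · rw [pow_one] at hζ
    rw [hζ, one_pow]
  · rw [Nat.one_mod_eq_one.mpr hm, pow_one]

/-- `ζ^a = ζ^{a mod m}` for an `m`-th root of unity. [folklore] -/
private theorem pow_eq_pow_mod {M : Type} [Monoid M] {m : ℕ} {ζ : M} (hζ : ζ ^ m = 1) (a : ℕ) :
    ζ ^ a = ζ ^ (a % m) := by
  conv_lhs => rw [← Nat.mod_add_div a m, pow_add, pow_mul, hζ, one_pow, mul_one]

/-! ## §1 The `ι`-standard root system and the offsets -/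

/-- **At every level there is a root `ρ ∈ ℚ(ζ_m)` read by `ι` as `exp(2πi/m)`** (Kato §4.2 fixes `ζ_N = exp(2πi/N) ∈ ℂ`;
here `ℚ(ζ_m)` is abstract and `ι` is a binder, so the standard root is FOUND, not fixed): `ι(ζ)` and `exp(2πi/m)` are both
primitive, hence `exp(2πi/m) = ι(ζ)^k` with `(k, m) = 1` and `ρ = ζ^k`. [cite: Kato2004Asterisque, §4.2 (p. 143)] -/
theorem exists_apply_eq_exp (m : ℕ) [NeZero m] (e : CyclotomicField m ℚ →+* ℂ) :
    ∃ ρ : CyclotomicField m ℚ, IsPrimitiveRoot ρ m ∧ e ρ = Complex.exp (2 * Real.pi * Complex.I / m) := by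
  have hζ := IsCyclotomicExtension.zeta_spec m ℚ (CyclotomicField m ℚ)
  have heζ : IsPrimitiveRoot (e (IsCyclotomicExtension.zeta m ℚ (CyclotomicField m ℚ))) m :=
    hζ.map_of_injective e.injective
  have hexp : IsPrimitiveRoot (Complex.exp (2 * Real.pi * Complex.I / m)) m :=
    Complex.isPrimitiveRoot_exp m (NeZero.ne m)
  obtain ⟨k, -, hk⟩ := heζ.eq_pow_of_pow_eq_one hexp.pow_eq_one
  have hcop : k.Coprime m := (heζ.pow_iff_coprime (NeZero.pos m) k).mp (hk ▸ hexp)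
  exact ⟨_, hζ.pow_of_coprime k hcop, by rw [map_pow, hk]⟩

/-- **The `ι`-STANDARD root system**: for every family `ι_m : ℚ(ζ_m) → ℂ` there are primitive `p^{n+1}`-th roots
`ρ_n ∈ ℚ(ζ_{p^{n+1}})` with `ι(ρ_n) = exp(2πi/p^{n+1})` for all `n` (Kato's `ζ_{p^{n+1}}` of §4.2 pulled back along `ι`).
[cite: Kato2004Asterisque, §4.2 (p. 143)] -/
theorem exists_standardRootSystem (ι : (m : ℕ) → (CyclotomicField m ℚ →+* ℂ)) :
    ∃ ρ : ∀ n : ℕ, CyclotomicField (cycLevel p (n + 1) ∅) ℚ,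
      (∀ n, IsPrimitiveRoot (ρ n) (p ^ (n + 1))) ∧
      ∀ n, ι (cycLevel p (n + 1) ∅) (ρ n) = Complex.exp (2 * Real.pi * Complex.I / (p ^ (n + 1) : ℂ)) := by
  have key : ∀ n : ℕ, ∃ ρn : CyclotomicField (cycLevel p (n + 1) ∅) ℚ, IsPrimitiveRoot ρn (p ^ (n + 1)) ∧
      ι (cycLevel p (n + 1) ∅) ρn = Complex.exp (2 * Real.pi * Complex.I / (p ^ (n + 1) : ℂ)) := by
    intro n
    obtain ⟨ρn, hprim, he⟩ := exists_apply_eq_exp (cycLevel p (n + 1) ∅) (ι _)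
    refine ⟨ρn, (congrArg (IsPrimitiveRoot ρn) (cycLevel_empty (p := p) (n + 1))).mp hprim, ?_⟩
    rw [he, cycLevel_empty, Nat.cast_pow]
  choose ρ hρ using key
  exact ⟨ρ, fun n => (hρ n).1, fun n => (hρ n).2⟩

/-- **An `ι`-standard root is primitive** (`exp(2πi/p^{n+1})` is, and `ι` is injective). [cite: Kato2004Asterisque, §4.2 (p. 143)] -/
theorem isPrimitiveRoot_of_apply_eq_exp {n : ℕ} {e : CyclotomicField (cycLevel p (n + 1) ∅) ℚ →+* ℂ}
    {ρn : CyclotomicField (cycLevel p (n + 1) ∅) ℚ}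
    (h : e ρn = Complex.exp (2 * Real.pi * Complex.I / (p ^ (n + 1) : ℂ))) :
    IsPrimitiveRoot ρn (p ^ (n + 1)) := by
  have hexp : IsPrimitiveRoot (Complex.exp (2 * Real.pi * Complex.I / (p ^ (n + 1) : ℂ))) (p ^ (n + 1)) := by
    have h' := Complex.isPrimitiveRoot_exp (p ^ (n + 1)) (pow_ne_zero _ hp.out.ne_zero)
    rwa [Nat.cast_pow] at h'
  rw [← h] at hexp
  exact hexp.of_map_of_injective e.injective

/-- **The OFFSETS of one primitive root system against another**: `μ_n = ρ_n^{o_n}` with `o_n ∈ (ℤ/p^{n+1})ˣ`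
(both primitive of order `p^{n+1} = m(n+1)`). [cite: Kobayashi2003, §8.4 (p. 16)] -/
theorem exists_offsets {μ ρ : ∀ n : ℕ, CyclotomicField (cycLevel p (n + 1) ∅) ℚ}
    (hμ : ∀ n, IsPrimitiveRoot (μ n) (p ^ (n + 1))) (hρ : ∀ n, IsPrimitiveRoot (ρ n) (p ^ (n + 1))) :
    ∃ o : ∀ n : ℕ, (ZMod (cycLevel p (n + 1) ∅))ˣ,
      ∀ n, μ n = ρ n ^ ((o n : ZMod (cycLevel p (n + 1) ∅)).val) := by
  have key : ∀ n : ℕ, ∃ on : (ZMod (cycLevel p (n + 1) ∅))ˣ,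
      μ n = ρ n ^ ((on : ZMod (cycLevel p (n + 1) ∅)).val) := by
    intro n
    have hρm : IsPrimitiveRoot (ρ n) (cycLevel p (n + 1) ∅) :=
      (congrArg (IsPrimitiveRoot (ρ n)) (cycLevel_empty (p := p) (n + 1))).mpr (hρ n)
    have hμm : IsPrimitiveRoot (μ n) (cycLevel p (n + 1) ∅) :=
      (congrArg (IsPrimitiveRoot (μ n)) (cycLevel_empty (p := p) (n + 1))).mpr (hμ n)
    obtain ⟨i, hi, hiμ⟩ := hρm.eq_pow_of_pow_eq_one hμm.pow_eq_one
    have hcop : i.Coprime (cycLevel p (n + 1) ∅) :=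
      (hρm.pow_iff_coprime (NeZero.pos _) i).mp (hiμ ▸ hμm)
    refine ⟨ZMod.unitOfCoprime i hcop, ?_⟩
    rw [ZMod.coe_unitOfCoprime, ZMod.val_natCast, Nat.mod_eq_of_lt hi, hiμ]
  choose o ho using key
  exact ⟨o, ho⟩

/-! ## §2 Coherent `p`-adic embeddings on any primitive root system; level-wise twisted families -/

/-- One level: an embedding `e : ℚ(ζ_{p^{n+1}}) → ℂ_p` with `e(ρ_n)^{pⁿ} = ξ` for a given primitive `p`-th root `ξ ∈ ℂ_p`
(precompose any embedding with `σ_b`). [cite: Kobayashi2003, §8.4 (p. 16)] -/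
theorem exists_embedding_pow_eq (n : ℕ) {ρn : CyclotomicField (cycLevel p (n + 1) ∅) ℚ}
    (hρ : IsPrimitiveRoot ρn (p ^ (n + 1))) {ξ : ℂ_[p]} (hξ : IsPrimitiveRoot ξ p) :
    ∃ e : CyclotomicField (cycLevel p (n + 1) ∅) ℚ →+* ℂ_[p], e ρn ^ (p ^ n) = ξ := by
  have hP : p.Prime := hp.out
  obtain ⟨e₀⟩ := nonempty_algHom_padicComplex (p := p) (cycLevel p (n + 1) ∅)
  have hρm : IsPrimitiveRoot ρn (cycLevel p (n + 1) ∅) :=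
    (congrArg (IsPrimitiveRoot ρn) (cycLevel_empty (p := p) (n + 1))).mpr hρ
  have hmeq : cycLevel p (n + 1) ∅ = p ^ n * p := by rw [cycLevel_empty, pow_succ]
  have hx : IsPrimitiveRoot (e₀ ρn ^ (p ^ n)) p :=
    (hρm.map_of_injective e₀.toRingHom.injective).pow (NeZero.pos _) hmeq
  obtain ⟨i, -, hi⟩ := hx.eq_pow_of_pow_eq_one hξ.pow_eq_one
  have hicop : i.Coprime p := (hx.pow_iff_coprime hP.pos i).mp (by rw [hi]; exact hξ)
  have hicopm : i.Coprime (cycLevel p (n + 1) ∅) := by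
    rw [cycLevel_empty]; exact Nat.Coprime.pow_right _ hicop
  set b : (ZMod (cycLevel p (n + 1) ∅))ˣ := ZMod.unitOfCoprime i hicopm with hb
  refine ⟨e₀.toRingHom.comp (sigma (cycLevel p (n + 1) ∅) b).toAlgHom.toRingHom, ?_⟩
  rw [RingHom.comp_apply]
  change e₀ (sigma (cycLevel p (n + 1) ∅) b ρn) ^ p ^ n = ξ
  rw [sigma_apply_of_pow_eq_one _ b ρn hρm.pow_eq_one, map_pow, ← pow_mul, mul_comm, pow_mul, hb,
    ZMod.coe_unitOfCoprime, ZMod.val_natCast]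
  have hxm : (e₀ ρn ^ p ^ n) ^ (cycLevel p (n + 1) ∅) = 1 := by
    rw [congrArg (fun k : ℕ => (e₀ ρn ^ p ^ n) ^ k) hmeq, mul_comm, pow_mul, hx.pow_eq_one, one_pow]
  rw [← hi, ← pow_eq_pow_mod hxm]

/-- **COHERENT `p`-ADIC EMBEDDINGS EXIST ON EVERY PRIMITIVE ROOT SYSTEM**: for primitive `p^{n+1}`-th roots
`ρ_n ∈ ℚ(ζ_{p^{n+1}})` there is a family `ιp_m : ℚ(ζ_m) → ℂ_p` with `ιp(ρ_n)^{pⁿ} = ιp(ρ_0)` for all `n`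
(`Kobayashi2003.IsCoherentPadicEmbeddings p ρ ιp`, the tame anchor (COH_ρ) of [A′]): fix `ξ = ιp_p(ρ_0)` and re-align
each level by `σ_b` (Kobayashi §8.4: the `p`-adic reading of the norm-coherent `(ζ_{p^{n+1}})_n` on `ℚ(ζ_p)`).
[cite: Kobayashi2003, §8.4 (p. 16)] -/
theorem exists_isCoherentPadicEmbeddings (ρ : ∀ n : ℕ, CyclotomicField (cycLevel p (n + 1) ∅) ℚ)
    (hρ : ∀ n, IsPrimitiveRoot (ρ n) (p ^ (n + 1))) :
    ∃ ιp : (m : ℕ) → (CyclotomicField m ℚ →+* ℂ_[p]), IsCoherentPadicEmbeddings p ρ ιp := by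
  obtain ⟨e₁⟩ := nonempty_algHom_padicComplex (p := p) (cycLevel p (0 + 1) ∅)
  have hξ : IsPrimitiveRoot (e₁ (ρ 0)) p := by
    have h : IsPrimitiveRoot (e₁ (ρ 0)) (p ^ (0 + 1)) := (hρ 0).map_of_injective e₁.toRingHom.injective
    exact (congrArg (IsPrimitiveRoot (e₁ (ρ 0))) (pow_one p)).mp h
  have key : ∀ n : ℕ, ∃ e : CyclotomicField (cycLevel p (n + 1) ∅) ℚ →+* ℂ_[p], e (ρ n) ^ (p ^ n) = e₁ (ρ 0) :=
    fun n => exists_embedding_pow_eq n (hρ n) hξ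
  choose g hg using key
  have hd : ∀ m : ℕ, Nonempty (CyclotomicField m ℚ →+* ℂ_[p]) := by
    intro m
    rcases Nat.eq_zero_or_pos m with rfl | hm
    · haveI : Algebra.IsAlgebraic ℚ (CyclotomicField 0 ℚ) := Algebra.IsAlgebraic.of_finite ℚ _
      haveI : Module.IsTorsionFree ℚ ℂ_[p] := DivisionSemiring.to_moduleIsTorsionFree
      exact ⟨(IsAlgClosed.lift : CyclotomicField 0 ℚ →ₐ[ℚ] ℂ_[p]).toRingHom⟩
    · haveI : NeZero m := ⟨hm.ne'⟩
      obtain ⟨e⟩ := nonempty_algHom_padicComplex (p := p) m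
      exact ⟨e.toRingHom⟩
  obtain ⟨ιp, hιp⟩ := exists_family_eq (X := fun m => CyclotomicField m ℚ →+* ℂ_[p])
    (fun m => Classical.choice (hd m)) g
  refine ⟨ιp, fun n => ?_⟩
  rw [hιp n, hιp 0, hg n, ← hg 0, pow_zero, pow_one]

/-- **Level-wise TWISTED FAMILIES exist**: for units `a_n ∈ (ℤ/p^{n+1})ˣ` there is a family `ιA` with
`ιA_{m(n+1)} = ιC_{m(n+1)} ∘ σ_{a_n}` at every pure `p`-power level (Kobayashi §8.4: the frames of two root systems differ
level-wise by `σ_{a_n}`). [cite: Kobayashi2003, §8.4 (p. 16)] -/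
theorem exists_twistedFamily (ιC : (m : ℕ) → (CyclotomicField m ℚ →+* ℂ_[p]))
    (a : ∀ n : ℕ, (ZMod (cycLevel p (n + 1) ∅))ˣ) :
    ∃ ιA : (m : ℕ) → (CyclotomicField m ℚ →+* ℂ_[p]),
      ∀ (n : ℕ) (x : CyclotomicField (cycLevel p (n + 1) ∅) ℚ),
        ιA (cycLevel p (n + 1) ∅) x = ιC (cycLevel p (n + 1) ∅) (sigma (cycLevel p (n + 1) ∅) (a n) x) := by
  obtain ⟨ιA, hιA⟩ := exists_family_eq (X := fun m => CyclotomicField m ℚ →+* ℂ_[p]) ιC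
    (fun n => (ιC (cycLevel p (n + 1) ∅)).comp (sigma (cycLevel p (n + 1) ∅) (a n)).toAlgHom.toRingHom)
  refine ⟨ιA, fun n x => ?_⟩
  rw [hιA n]
  rfl

/-- **A twisted family is coherent on the twisted root system**: if `ιC` is coherent on `ρ`
(`IsCoherentPadicEmbeddings p ρ ιC`), `μ_n = ρ_n^{o_n}` and `ιA_{m(n+1)} = ιC_{m(n+1)} ∘ σ_{o_n⁻¹}`, then
`ιA(μ_n) = ιC(ρ_n)` and `ιA` is coherent on `μ` (Kobayashi §8.4: (COH) is a property of the pair (roots, readings)).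
[cite: Kobayashi2003, §8.4 (p. 16)] -/
theorem apply_eq_of_twisted {ιA ιC : (m : ℕ) → (CyclotomicField m ℚ →+* ℂ_[p])}
    {μ ρ : ∀ n : ℕ, CyclotomicField (cycLevel p (n + 1) ∅) ℚ} {o : ∀ n : ℕ, (ZMod (cycLevel p (n + 1) ∅))ˣ}
    (hρ : ∀ n, IsPrimitiveRoot (ρ n) (p ^ (n + 1)))
    (ho : ∀ n, μ n = ρ n ^ ((o n : ZMod (cycLevel p (n + 1) ∅)).val))
    (hA : ∀ (n : ℕ) (x : CyclotomicField (cycLevel p (n + 1) ∅) ℚ),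
      ιA (cycLevel p (n + 1) ∅) x = ιC (cycLevel p (n + 1) ∅) (sigma (cycLevel p (n + 1) ∅) (o n)⁻¹ x))
    (n : ℕ) : ιA (cycLevel p (n + 1) ∅) (μ n) = ιC (cycLevel p (n + 1) ∅) (ρ n) := by
  have hρm : (ρ n) ^ (cycLevel p (n + 1) ∅) = 1 :=
    ((congrArg (IsPrimitiveRoot (ρ n)) (cycLevel_empty (p := p) (n + 1))).mpr (hρ n)).pow_eq_one
  have hμm : (μ n) ^ (cycLevel p (n + 1) ∅) = 1 := by
    rw [ho n, ← pow_mul, mul_comm, pow_mul, hρm, one_pow]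
  rw [hA n, sigma_apply_of_pow_eq_one _ _ _ hμm, ho n, pow_val_pow_val_inv hρm]

/-- Corollary: the twisted family is coherent on `μ`. [cite: Kobayashi2003, §8.4 (p. 16)] -/
theorem isCoherentPadicEmbeddings_of_twisted {ιA ιC : (m : ℕ) → (CyclotomicField m ℚ →+* ℂ_[p])}
    {μ ρ : ∀ n : ℕ, CyclotomicField (cycLevel p (n + 1) ∅) ℚ} {o : ∀ n : ℕ, (ZMod (cycLevel p (n + 1) ∅))ˣ}
    (hρ : ∀ n, IsPrimitiveRoot (ρ n) (p ^ (n + 1)))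
    (ho : ∀ n, μ n = ρ n ^ ((o n : ZMod (cycLevel p (n + 1) ∅)).val))
    (hA : ∀ (n : ℕ) (x : CyclotomicField (cycLevel p (n + 1) ∅) ℚ),
      ιA (cycLevel p (n + 1) ∅) x = ιC (cycLevel p (n + 1) ∅) (sigma (cycLevel p (n + 1) ∅) (o n)⁻¹ x))
    (hC : IsCoherentPadicEmbeddings p ρ ιC) : IsCoherentPadicEmbeddings p μ ιA := by
  intro n
  rw [apply_eq_of_twisted hρ ho hA n, apply_eq_of_twisted hρ ho hA 0]
  exact hC n

/-! ## §3 Re-framing Kobayashi's `p`-adic sums along `ιp ↦ ιp ∘ σ_a` -/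

/-- **The Gauss sum at a named root, re-framed**: if `ιA = ιC ∘ σ_a` then `τ^{ιA}_ζ(θ) = τ^{ιC}_{ζ^a}(θ)`
(Kobayashi Prop. 8.26: `τ(ψ) = Σ ψ(σ) ζ^σ` depends on the pair (root, reading) only through `ιp(ζ)`).
[cite: Kobayashi2003, Prop. 8.26 (p. 25) and §8.4 (p. 16)] -/
theorem padicGaussSumAt_eq_of_comp_sigma {m : ℕ} [NeZero m] (ιA ιC : CyclotomicField m ℚ →+* ℂ_[p])
    (a : (ZMod m)ˣ) (h : ∀ x, ιA x = ιC (sigma m a x)) {ζ : CyclotomicField m ℚ} (hζ : ζ ^ m = 1)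
    (θ : DirichletCharacter ℂ_[p] m) :
    padicGaussSumAt p m ιA ζ θ = padicGaussSumAt p m ιC (ζ ^ (a : ZMod m).val) θ := by
  rw [padicGaussSumAt_def, padicGaussSumAt_def, h ζ, sigma_apply_of_pow_eq_one m a ζ hζ]

omit hp in
/-- `σ_{ab} = σ_a ∘ σ_b` on `ℚ(ζ_m)`. [cite: Kato2004Asterisque, (5.7.1) (p. 157)] -/
theorem sigma_mul_apply {m : ℕ} [NeZero m] (a b : (ZMod m)ˣ) (x : CyclotomicField m ℚ) :
    sigma m (a * b) x = sigma m a (sigma m b x) := by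
  have hmul : sigma m (a * b) = sigma m a * sigma m b := by
    unfold sigma
    exact map_mul _ a b
  rw [hmul, AlgEquiv.mul_apply]

/-- **Kobayashi's `p`-adic character sum, re-framed**: if `ιA = ιC ∘ σ_a` then
`Σ_b θ(b)·(s ⊗ x ↦ s·ιA(σ_b x))(y) = θ(a⁻¹) · Σ_b θ(b)·(s ⊗ x ↦ s·ιC(σ_b x))(y)` (re-index `b ↦ ab`; Prop. 8.25/(8.29)
read in two frames). [cite: Kobayashi2003, Prop. 8.25 and (8.29) (p. 24), §8.4 (p. 16)] -/
theorem padicCharSum_eq_of_comp_sigma {m : ℕ} [NeZero m] (ιA ιC : CyclotomicField m ℚ →+* ℂ_[p])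
    (a : (ZMod m)ˣ) (h : ∀ x, ιA x = ιC (sigma m a x)) (θ : DirichletCharacter ℂ_[p] m)
    (y : ℚ_[p] ⊗[ℚ] CyclotomicField m ℚ) :
    padicCharSum p m ιA θ y = θ ((a⁻¹ : (ZMod m)ˣ) : ZMod m) * padicCharSum p m ιC θ y := by
  have hread : ∀ b : (ZMod m)ˣ, padicReadOff p m ιA b y = padicReadOff p m ιC (a * b) y := by
    intro b
    induction y using TensorProduct.induction_on with
    | zero => rw [map_zero, map_zero]
    | tmul s x => rw [padicReadOff_tmul, padicReadOff_tmul, h, sigma_mul_apply]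
    | add y₁ y₂ h₁ h₂ => rw [map_add, map_add, h₁, h₂]
  have hθa : θ ((a⁻¹ : (ZMod m)ˣ) : ZMod m) * θ (a : ZMod m) = 1 := by
    rw [← map_mul, ← Units.val_mul, inv_mul_cancel, Units.val_one, map_one]
  rw [padicCharSum_def, padicCharSum_def, Finset.mul_sum]
  simp_rw [hread]
  refine Fintype.sum_equiv (Equiv.mulLeft a) _ _ fun b => ?_
  rw [Equiv.coe_mulLeft, Units.val_mul, map_mul, ← mul_assoc, ← mul_assoc, hθa, one_mul]

/-! ## §4 The level map `j_n`, the unit `t_n` of (D1), the trace identity (D2) and the character-sum descent (D3) -/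

/-- The level map `j : ℚ(ζ_{p^{n+1}}) → ℚ(ζ_{p^{n+2}})` with `j(μ_n) = μ_{n+1}^p` exists (`μ_{n+1}^p` is a primitive
`p^{n+1}`-th root; Mathlib `IsPrimitiveRoot.embeddingsEquivPrimitiveRoots`). [folklore] -/
private theorem exists_algHom_apply_eq_pow {n : ℕ} {μn : CyclotomicField (cycLevel p (n + 1) ∅) ℚ}
    {μs : CyclotomicField (cycLevel p (n + 2) ∅) ℚ}
    (hμn' : IsPrimitiveRoot μn (p ^ (n + 1))) (hμs' : IsPrimitiveRoot μs (p ^ (n + 2))) :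
    ∃ j : CyclotomicField (cycLevel p (n + 1) ∅) ℚ →ₐ[ℚ] CyclotomicField (cycLevel p (n + 2) ∅) ℚ,
      j μn = μs ^ p := by
  have hμn : IsPrimitiveRoot μn (cycLevel p (n + 1) ∅) :=
    (congrArg (IsPrimitiveRoot μn) (cycLevel_empty (p := p) (n + 1))).mpr hμn'
  have hμs : IsPrimitiveRoot μs (cycLevel p (n + 2) ∅) :=
    (congrArg (IsPrimitiveRoot μs) (cycLevel_empty (p := p) (n + 2))).mpr hμs'
  have hirr : Irreducible (cyclotomic (cycLevel p (n + 1) ∅) ℚ) :=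
    cyclotomic.irreducible_rat (NeZero.pos _)
  have hpow : IsPrimitiveRoot (μs ^ p) (cycLevel p (n + 1) ∅) := by
    have hp_dvd : p ∣ cycLevel p (n + 2) ∅ := by
      rw [cycLevel_empty]; exact dvd_pow_self p (Nat.succ_ne_zero _)
    have h := hμs.pow_of_dvd hp.out.ne_zero hp_dvd
    have hdiv : cycLevel p (n + 2) ∅ / p = cycLevel p (n + 1) ∅ := by
      rw [cycLevel_empty, cycLevel_empty, pow_succ, Nat.mul_div_cancel _ hp.out.pos]
    rwa [hdiv] at h
  have hmem : μs ^ p ∈ primitiveRoots (cycLevel p (n + 1) ∅) (CyclotomicField (cycLevel p (n + 2) ∅) ℚ) :=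
    (mem_primitiveRoots (NeZero.pos _)).mpr hpow
  refine ⟨(hμn.embeddingsEquivPrimitiveRoots (CyclotomicField (cycLevel p (n + 2) ∅) ℚ) hirr).symm
    ⟨μs ^ p, hmem⟩, ?_⟩
  have h := hμn.embeddingsEquivPrimitiveRoots_apply_coe (CyclotomicField (cycLevel p (n + 2) ∅) ℚ) hirr
    ((hμn.embeddingsEquivPrimitiveRoots (CyclotomicField (cycLevel p (n + 2) ∅) ℚ) hirr).symm ⟨μs ^ p, hmem⟩)
  rw [Equiv.apply_symm_apply] at h
  exact h.symm

/-- Two `ℚ`-algebra maps out of `ℚ(ζ_{p^{n+1}})` that agree on a primitive root agree. [folklore] -/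
private theorem algHom_ext_of_apply_eq {n : ℕ} {B : Type} [CommRing B] [Algebra ℚ B]
    {μn : CyclotomicField (cycLevel p (n + 1) ∅) ℚ} (hμn' : IsPrimitiveRoot μn (p ^ (n + 1)))
    {j j' : CyclotomicField (cycLevel p (n + 1) ∅) ℚ →ₐ[ℚ] B} (h : j μn = j' μn) : j = j' := by
  have hμn : IsPrimitiveRoot μn (cycLevel p (n + 1) ∅) :=
    (congrArg (IsPrimitiveRoot μn) (cycLevel_empty (p := p) (n + 1))).mpr hμn'
  refine (hμn.powerBasis ℚ).algHom_ext ?_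
  rw [IsPrimitiveRoot.powerBasis_gen]
  exact h

/-- **The level map commutes with the Galois action through `π : (ℤ/p^{n+2})ˣ → (ℤ/p^{n+1})ˣ`**:
`σ_b ∘ j = j ∘ σ_{π b}` (`ℚ(ζ_{p^{n+1}})/ℚ` is abelian; checked on the generator `μ_n`).
[cite: Kato2004Asterisque, (5.7.1) (p. 157)] -/
theorem sigma_apply_algHom {n : ℕ} {μn : CyclotomicField (cycLevel p (n + 1) ∅) ℚ}
    {μs : CyclotomicField (cycLevel p (n + 2) ∅) ℚ}
    (hμn : IsPrimitiveRoot μn (p ^ (n + 1))) (hμs : IsPrimitiveRoot μs (p ^ (n + 2)))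
    (j : CyclotomicField (cycLevel p (n + 1) ∅) ℚ →ₐ[ℚ] CyclotomicField (cycLevel p (n + 2) ∅) ℚ)
    (hj : j μn = μs ^ p) (b : (ZMod (cycLevel p (n + 2) ∅))ˣ) (y : CyclotomicField (cycLevel p (n + 1) ∅) ℚ) :
    sigma (cycLevel p (n + 2) ∅) b (j y) =
      j (sigma (cycLevel p (n + 1) ∅)
        (ZMod.unitsMap (show cycLevel p (n + 1) ∅ ∣ cycLevel p (n + 2) ∅ from
          mul_dvd_mul_right (pow_dvd_pow p (Nat.le_succ (n + 1))) _) b) y) := by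
  set hd : cycLevel p (n + 1) ∅ ∣ cycLevel p (n + 2) ∅ := mul_dvd_mul_right (pow_dvd_pow p (Nat.le_succ (n + 1))) _
  have hμn1 : μn ^ (cycLevel p (n + 1) ∅) = 1 :=
    ((congrArg (IsPrimitiveRoot μn) (cycLevel_empty (p := p) (n + 1))).mpr hμn).pow_eq_one
  have hμs1 : μs ^ (cycLevel p (n + 2) ∅) = 1 :=
    ((congrArg (IsPrimitiveRoot μs) (cycLevel_empty (p := p) (n + 2))).mpr hμs).pow_eq_one
  have key : (sigma (cycLevel p (n + 2) ∅) b).toAlgHom.comp j =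
      j.comp (sigma (cycLevel p (n + 1) ∅) (ZMod.unitsMap hd b)).toAlgHom := by
    refine algHom_ext_of_apply_eq hμn ?_
    change sigma (cycLevel p (n + 2) ∅) b (j μn) = j (sigma (cycLevel p (n + 1) ∅) (ZMod.unitsMap hd b) μn)
    rw [hj, map_pow, sigma_apply_of_pow_eq_one _ b μs hμs1, sigma_apply_of_pow_eq_one _ _ μn hμn1, map_pow, hj,
      ← pow_mul, ← pow_mul]
    have hr : ((b : (ZMod (cycLevel p (n + 2) ∅))ˣ) : ZMod (cycLevel p (n + 2) ∅)).val =
        cycLevel p (n + 1) ∅ * ((((b : (ZMod (cycLevel p (n + 2) ∅))ˣ) : ZMod (cycLevel p (n + 2) ∅)).val) /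
          cycLevel p (n + 1) ∅) +
        ((ZMod.unitsMap hd b : (ZMod (cycLevel p (n + 1) ∅))ˣ) : ZMod (cycLevel p (n + 1) ∅)).val := by
      rw [ZMod.unitsMap_val, ZMod.cast_eq_val, ZMod.val_natCast]
      exact (Nat.div_add_mod _ _).symm
    have hq : ((b : (ZMod (cycLevel p (n + 2) ∅))ˣ) : ZMod (cycLevel p (n + 2) ∅)).val * p =
        p * ((ZMod.unitsMap hd b : (ZMod (cycLevel p (n + 1) ∅))ˣ) : ZMod (cycLevel p (n + 1) ∅)).val +
        (p * cycLevel p (n + 1) ∅) *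
          ((((b : (ZMod (cycLevel p (n + 2) ∅))ˣ) : ZMod (cycLevel p (n + 2) ∅)).val) / cycLevel p (n + 1) ∅) := by
      nth_rewrite 1 [hr]
      ring
    have hμs1' : μs ^ (p * cycLevel p (n + 1) ∅) = 1 := by
      rw [← cycLevel_succ_succ]; exact hμs1
    rw [hq, pow_add, pow_mul μs (p * cycLevel p (n + 1) ∅), hμs1', one_pow, mul_one]
  exact congrArg (fun φ : CyclotomicField (cycLevel p (n + 1) ∅) ℚ →ₐ[ℚ] CyclotomicField (cycLevel p (n + 2) ∅) ℚ =>
    φ y) key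

/-- **(D1) Two complex frames of `ℚ(ζ_{p^{n+1}})` differ by a unit**: for embeddings `ι₁` of level `n+1`, `ι₂` of level
`n+2` and a level map `j` there is `t ∈ (ℤ/p^{n+1})ˣ` with `ι₂ ∘ j = ι₁ ∘ σ_t` (`ι₂(j ρ)` and `ι₁(ρ)` are primitive
`p^{n+1}`-th roots of unity in `ℂ`). [cite: Kato2004Asterisque, §4.2 (p. 143) and (5.7.1) (p. 157)] -/
theorem exists_unit_comp_eq {n : ℕ} (ι₁ : CyclotomicField (cycLevel p (n + 1) ∅) ℚ →+* ℂ)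
    (ι₂ : CyclotomicField (cycLevel p (n + 2) ∅) ℚ →+* ℂ)
    (j : CyclotomicField (cycLevel p (n + 1) ∅) ℚ →ₐ[ℚ] CyclotomicField (cycLevel p (n + 2) ∅) ℚ)
    {ρn : CyclotomicField (cycLevel p (n + 1) ∅) ℚ} (hρ : IsPrimitiveRoot ρn (p ^ (n + 1))) :
    ∃ t : (ZMod (cycLevel p (n + 1) ∅))ˣ,
      ∀ y : CyclotomicField (cycLevel p (n + 1) ∅) ℚ, ι₂ (j y) = ι₁ (sigma (cycLevel p (n + 1) ∅) t y) := by
  have hρm : IsPrimitiveRoot ρn (cycLevel p (n + 1) ∅) :=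
    (congrArg (IsPrimitiveRoot ρn) (cycLevel_empty (p := p) (n + 1))).mpr hρ
  have hζ₁ : IsPrimitiveRoot (ι₁ ρn) (cycLevel p (n + 1) ∅) := hρm.map_of_injective ι₁.injective
  have hξ : IsPrimitiveRoot ((ι₂.comp j.toRingHom) ρn) (cycLevel p (n + 1) ∅) :=
    hρm.map_of_injective (ι₂.comp j.toRingHom).injective
  obtain ⟨k, -, hk⟩ := hζ₁.eq_pow_of_pow_eq_one hξ.pow_eq_one
  have hcop : k.Coprime (cycLevel p (n + 1) ∅) := (hζ₁.pow_iff_coprime (NeZero.pos _) k).mp (hk ▸ hξ)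
  refine ⟨ZMod.unitOfCoprime k hcop, fun y => ?_⟩
  have key : (ι₂.comp j.toRingHom).toRatAlgHom =
      (ι₁.comp (sigma (cycLevel p (n + 1) ∅) (ZMod.unitOfCoprime k hcop)).toAlgHom.toRingHom).toRatAlgHom := by
    refine algHom_ext_of_apply_eq hρ ?_
    change (ι₂.comp j.toRingHom) ρn = ι₁ (sigma (cycLevel p (n + 1) ∅) (ZMod.unitOfCoprime k hcop) ρn)
    rw [← hk, sigma_apply_of_pow_eq_one _ _ ρn hρm.pow_eq_one, map_pow, ZMod.coe_unitOfCoprime, ZMod.val_natCast,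
      ← pow_eq_pow_mod hζ₁.pow_eq_one]
  have h := congrArg (fun φ : CyclotomicField (cycLevel p (n + 1) ∅) ℚ →ₐ[ℚ] ℂ => φ y) key
  exact h

/-- `Σ_{b ∈ (ℤ/m₂)ˣ} F(π b) = #ker(π) · Σ_{b̄ ∈ (ℤ/m₁)ˣ} F(b̄)` for the reduction `π` (all fibres have `#ker π`
elements). [folklore] -/
private theorem sum_comp_unitsMap {m₁ m₂ : ℕ} [NeZero m₁] [NeZero m₂] (hd : m₁ ∣ m₂) {M : Type} [AddCommMonoid M]
    (F : (ZMod m₁)ˣ → M) :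
    ∑ b : (ZMod m₂)ˣ, F (ZMod.unitsMap hd b) =
      (Finset.univ.filter fun e : (ZMod m₂)ˣ => ZMod.unitsMap hd e = 1).card • ∑ b : (ZMod m₁)ˣ, F b := by
  classical
  rw [← Finset.sum_fiberwise_of_maps_to (s := Finset.univ) (t := Finset.univ) (g := ZMod.unitsMap hd)
    (fun _ _ => Finset.mem_univ _) (fun b => F (ZMod.unitsMap hd b)), Finset.smul_sum]
  refine Finset.sum_congr rfl fun b₀ _ => ?_
  have hfib : ∀ b ∈ Finset.univ.filter (fun b : (ZMod m₂)ˣ => ZMod.unitsMap hd b = b₀),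
      F (ZMod.unitsMap hd b) = F b₀ := by
    intro b hb
    rw [(Finset.mem_filter.mp hb).2]
  rw [Finset.sum_congr rfl hfib, Finset.sum_const]
  congr 1
  obtain ⟨b₁, hb₁⟩ := ZMod.unitsMap_surjective hd b₀
  have hfiber : Finset.univ.filter (fun b : (ZMod m₂)ˣ => ZMod.unitsMap hd b = b₀) =
      (Finset.univ.filter fun e : (ZMod m₂)ˣ => ZMod.unitsMap hd e = 1).image (fun e => b₁ * e) := by
    ext b
    simp only [Finset.mem_filter, Finset.mem_univ, true_and, Finset.mem_image]
    constructor
    · intro hb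
      refine ⟨b₁⁻¹ * b, ?_, by rw [mul_inv_cancel_left]⟩
      rw [map_mul, map_inv, hb, hb₁, inv_mul_cancel]
    · rintro ⟨e, he, rfl⟩
      rw [map_mul, he, mul_one, hb₁]
  rw [hfiber, Finset.card_image_of_injective _ (mul_right_injective b₁)]

/-- **(D3) CHARACTER-SUM DESCENT**: if `ι₂ ∘ j = ι₁ ∘ σ_t` (D1) and `j(x₁) = Σ_{c ≡ 1 (p^{n+1})} σ_c x₂` (D2), then for every
Dirichlet character `χ` mod `p^{n+1}`, Kato's character sum of Thm. 6.6 (1) descends: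
`Σ_{b ∈ (ℤ/p^{n+2})ˣ} χ(π b) ι₂(σ_b x₂) = χ(t⁻¹) · Σ_{b̄ ∈ (ℤ/p^{n+1})ˣ} χ(b̄) ι₁(σ_{b̄} x₁)`.
[cite: Kato2004Asterisque, Thm. 6.6 (1) (p. 163), Prop. 8.12 (p. 186), (5.7.1) (p. 157)] -/
theorem charSum_changeLevel_eq {n : ℕ} (ι₁ : CyclotomicField (cycLevel p (n + 1) ∅) ℚ →+* ℂ)
    (ι₂ : CyclotomicField (cycLevel p (n + 2) ∅) ℚ →+* ℂ)
    (j : CyclotomicField (cycLevel p (n + 1) ∅) ℚ →ₐ[ℚ] CyclotomicField (cycLevel p (n + 2) ∅) ℚ)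
    {μn : CyclotomicField (cycLevel p (n + 1) ∅) ℚ} {μs : CyclotomicField (cycLevel p (n + 2) ∅) ℚ}
    (hμn : IsPrimitiveRoot μn (p ^ (n + 1))) (hμs : IsPrimitiveRoot μs (p ^ (n + 2))) (hj : j μn = μs ^ p)
    {t : (ZMod (cycLevel p (n + 1) ∅))ˣ}
    (ht : ∀ y : CyclotomicField (cycLevel p (n + 1) ∅) ℚ, ι₂ (j y) = ι₁ (sigma (cycLevel p (n + 1) ∅) t y))
    {x₁ : CyclotomicField (cycLevel p (n + 1) ∅) ℚ} {x₂ : CyclotomicField (cycLevel p (n + 2) ∅) ℚ}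
    (hx : j x₁ = ∑ e ∈ (Finset.univ.filter fun e : (ZMod (cycLevel p (n + 2) ∅))ˣ =>
        ZMod.unitsMap (show cycLevel p (n + 1) ∅ ∣ cycLevel p (n + 2) ∅ from
          mul_dvd_mul_right (pow_dvd_pow p (Nat.le_succ (n + 1))) _) e = 1),
        sigma (cycLevel p (n + 2) ∅) e x₂)
    (χ : DirichletCharacter ℂ (cycLevel p (n + 1) ∅)) :
    charSum (cycLevel p (n + 2) ∅) ι₂
        (DirichletCharacter.changeLevel (show cycLevel p (n + 1) ∅ ∣ cycLevel p (n + 2) ∅ from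
          mul_dvd_mul_right (pow_dvd_pow p (Nat.le_succ (n + 1))) _) χ) x₂ =
      χ ((t⁻¹ : (ZMod (cycLevel p (n + 1) ∅))ˣ) : ZMod (cycLevel p (n + 1) ∅)) *
        charSum (cycLevel p (n + 1) ∅) ι₁ χ x₁ := by
  classical
  set hd : cycLevel p (n + 1) ∅ ∣ cycLevel p (n + 2) ∅ := mul_dvd_mul_right (pow_dvd_pow p (Nat.le_succ (n + 1))) _
  set π := ZMod.unitsMap hd with hπ
  set K := Finset.univ.filter fun e : (ZMod (cycLevel p (n + 2) ∅))ˣ => π e = 1 with hK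
  set χ₂ := DirichletCharacter.changeLevel hd χ with hχ₂def
  have hχ₂ : ∀ b : (ZMod (cycLevel p (n + 2) ∅))ˣ, χ₂ (b : ZMod (cycLevel p (n + 2) ∅)) =
      χ ((π b : (ZMod (cycLevel p (n + 1) ∅))ˣ) : ZMod (cycLevel p (n + 1) ∅)) := by
    intro b
    rw [hχ₂def, DirichletCharacter.changeLevel_eq_cast_of_dvd χ hd b, hπ, ZMod.unitsMap_val]
  have hK1 : ∀ e ∈ K, χ₂ (e : ZMod (cycLevel p (n + 2) ∅)) = 1 := by
    intro e he
    rw [hχ₂, (Finset.mem_filter.mp he).2, Units.val_one, map_one]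
  have hKpos : K.card ≠ 0 := by
    rw [Finset.card_ne_zero]
    exact ⟨1, Finset.mem_filter.mpr ⟨Finset.mem_univ _, map_one π⟩⟩
  -- Step A: averaging over the kernel
  set G : (ZMod (cycLevel p (n + 2) ∅))ˣ → ℂ := fun b =>
    χ₂ (b : ZMod (cycLevel p (n + 2) ∅)) * ι₂ (sigma (cycLevel p (n + 2) ∅) b x₂) with hG
  have hA : ∑ b : (ZMod (cycLevel p (n + 2) ∅))ˣ, ∑ e ∈ K, G (b * e) =
      K.card • charSum (cycLevel p (n + 2) ∅) ι₂ χ₂ x₂ := by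
    rw [Finset.sum_comm]
    have h1 : ∀ e ∈ K, ∑ b : (ZMod (cycLevel p (n + 2) ∅))ˣ, G (b * e) =
        ∑ b : (ZMod (cycLevel p (n + 2) ∅))ˣ, G b :=
      fun e _ => Fintype.sum_equiv (Equiv.mulRight e) _ _ fun b => rfl
    rw [Finset.sum_congr rfl h1, Finset.sum_const]
    rfl
  -- Step B: the inner sums are `χ₂(b) · ι₂(σ_b (j x₁))`
  have hB : ∀ b : (ZMod (cycLevel p (n + 2) ∅))ˣ, ∑ e ∈ K, G (b * e) =
      χ ((π b : (ZMod (cycLevel p (n + 1) ∅))ˣ) : ZMod (cycLevel p (n + 1) ∅)) *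
        ι₁ (sigma (cycLevel p (n + 1) ∅) (t * π b) x₁) := by
    intro b
    have h1 : ∀ e ∈ K, G (b * e) = χ₂ (b : ZMod (cycLevel p (n + 2) ∅)) *
        ι₂ (sigma (cycLevel p (n + 2) ∅) b (sigma (cycLevel p (n + 2) ∅) e x₂)) := by
      intro e he
      simp only [hG]
      rw [Units.val_mul, map_mul, hK1 e he, mul_one, sigma_mul_apply]
    rw [Finset.sum_congr rfl h1, ← Finset.mul_sum, ← map_sum, ← map_sum, ← hx, hχ₂,
      sigma_apply_algHom hμn hμs j hj b x₁, ht, sigma_mul_apply]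
  -- Step C: descend the outer sum to `(ℤ/p^{n+1})ˣ`
  have hC : ∑ b : (ZMod (cycLevel p (n + 2) ∅))ˣ, ∑ e ∈ K, G (b * e) =
      K.card • ∑ b : (ZMod (cycLevel p (n + 1) ∅))ˣ,
        χ (b : ZMod (cycLevel p (n + 1) ∅)) * ι₁ (sigma (cycLevel p (n + 1) ∅) (t * b) x₁) := by
    rw [Finset.sum_congr rfl fun b _ => hB b]
    exact sum_comp_unitsMap hd fun b => χ (b : ZMod (cycLevel p (n + 1) ∅)) *
      ι₁ (sigma (cycLevel p (n + 1) ∅) (t * b) x₁)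
  -- Step D: re-index `b ↦ t b`
  have hD : ∑ b : (ZMod (cycLevel p (n + 1) ∅))ˣ,
        χ (b : ZMod (cycLevel p (n + 1) ∅)) * ι₁ (sigma (cycLevel p (n + 1) ∅) (t * b) x₁) =
      χ ((t⁻¹ : (ZMod (cycLevel p (n + 1) ∅))ˣ) : ZMod (cycLevel p (n + 1) ∅)) *
        charSum (cycLevel p (n + 1) ∅) ι₁ χ x₁ := by
    unfold charSum
    rw [Finset.mul_sum]
    refine Fintype.sum_equiv (Equiv.mulLeft t) _ _ fun b => ?_
    rw [Equiv.coe_mulLeft, ← mul_assoc, ← map_mul, ← Units.val_mul, inv_mul_cancel_left]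
  -- assemble and cancel `#K`
  have hfin : (K.card : ℂ) * charSum (cycLevel p (n + 2) ∅) ι₂ χ₂ x₂ =
      (K.card : ℂ) * (χ ((t⁻¹ : (ZMod (cycLevel p (n + 1) ∅))ˣ) : ZMod (cycLevel p (n + 1) ∅)) *
        charSum (cycLevel p (n + 1) ∅) ι₁ χ x₁) := by
    rw [← nsmul_eq_mul, ← nsmul_eq_mul, ← hA, hC, hD]
  exact mul_left_cancel₀ (Nat.cast_ne_zero.mpr hKpos) hfin

set_option maxHeartbeats 800000 in
/-- **(D2) THE TRACE IDENTITY ON KATO'S VALUES**: for a Kato zeta family `(z, x)` with values in the frame `Λ`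
(`ZetaBody`: (C1) `cor z_{p^{n+2}} = z_{p^{n+1}}`, (C4) `Λ(z_m) = 1 ⊗ x_m`) and a root system TRACE-coherent with `Λ`
(`IsTraceCoherentRootSystem`), the declared coordinates satisfy `j_n(x_{p^{n+1}}) = Σ_{c ≡ 1 (p^{n+1})} σ_c x_{p^{n+2}}`
(`exp* ∘ cor = Tr ∘ exp*`, Prop. 8.12 with §9.4, read on (C4) through the injection `x ↦ 1 ⊗ x`).
[cite: Kato2004Asterisque, Prop. 8.12 (p. 186), §9.4 (p. 188), Thm. 9.7 (p. 189)] -/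
theorem algHom_apply_eq_sum_sigma {W : WeierstrassCurve ℚ} [W.IsElliptic] [ContinuousSMul ℤ_[p] (W.tateModule p)]
    [Module.Free ℤ_[p] (W.tateModule p)] [Module.Finite ℤ_[p] (W.tateModule p)]
    {N : ℕ} {f : CuspForm (Gamma0 N) 2} {ι : (m : ℕ) → (CyclotomicField m ℚ →+* ℂ)} {κK : ℝ}
    {Λ : ∀ (k : ℕ) (r : Finset (HeightOneSpectrum (𝓞 ℚ))),
      H1 (tateRep W p) (cycSubgroup p k r) →ₗ[ℤ_[p]] ℚ_[p] ⊗[ℚ] CyclotomicField (cycLevel p k r) ℚ}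
    {c d a : ℤ} {A : ℕ}
    {z : ∀ (k : ℕ) (r : (cyclotomicLevelsRat p (badPlaces c d A N)).Ideals),
      H1 (tateRep W p) ((cyclotomicLevelsRat p (badPlaces c d A N)).level k r.1)}
    {x : ∀ (k : ℕ) (r : (cyclotomicLevelsRat p (badPlaces c d A N)).Ideals), CyclotomicField (cycLevel p k r.1) ℚ}
    (hzeta : ZetaBody W p f ι κK Λ c d a A z x)
    {μ : ∀ n : ℕ, CyclotomicField (cycLevel p (n + 1) ∅) ℚ} (hμ : IsTraceCoherentRootSystem W p Λ μ) (n : ℕ)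
    (j : CyclotomicField (cycLevel p (n + 1) ∅) ℚ →ₐ[ℚ] CyclotomicField (cycLevel p (n + 2) ∅) ℚ)
    (hj : j (μ n) = μ (n + 1) ^ p) :
    j (x (n + 1) (cyclotomicLevelsRat p (badPlaces c d A N)).idealOne) =
      ∑ e ∈ (Finset.univ.filter fun e : (ZMod (cycLevel p (n + 2) ∅))ˣ =>
        ZMod.unitsMap (show cycLevel p (n + 1) ∅ ∣ cycLevel p (n + 2) ∅ from
          mul_dvd_mul_right (pow_dvd_pow p (Nat.le_succ (n + 1))) _) e = 1),
        sigma (cycLevel p (n + 2) ∅) e (x (n + 2) (cyclotomicLevelsRat p (badPlaces c d A N)).idealOne) := by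
  have hT := hμ.2 n j hj (z (n + 2) (cyclotomicLevelsRat p (badPlaces c d A N)).idealOne)
  have hx₂ : Λ (n + 2) ∅ (z (n + 2) (cyclotomicLevelsRat p (badPlaces c d A N)).idealOne) =
      (1 : ℚ_[p]) ⊗ₜ[ℚ] x (n + 2) (cyclotomicLevelsRat p (badPlaces c d A N)).idealOne :=
    hzeta.2.2.2.2.1 (n + 2) (cyclotomicLevelsRat p (badPlaces c d A N)).idealOne
  have hco : (cyclotomicLevelsRat p (∅ : Set (HeightOneSpectrum (𝓞 ℚ)))).coresP (tateRep W p)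
      (Nat.le_succ (n + 1)) ∅ (z (n + 2) (cyclotomicLevelsRat p (badPlaces c d A N)).idealOne) =
        z (n + 1) (cyclotomicLevelsRat p (badPlaces c d A N)).idealOne :=
    hzeta.1.cores_p (Nat.le_succ (n + 1)) (cyclotomicLevelsRat p (badPlaces c d A N)).idealOne
  have hx₁ : Λ (n + 1) ∅ (z (n + 1) (cyclotomicLevelsRat p (badPlaces c d A N)).idealOne) =
      (1 : ℚ_[p]) ⊗ₜ[ℚ] x (n + 1) (cyclotomicLevelsRat p (badPlaces c d A N)).idealOne :=
    hzeta.2.2.2.2.1 (n + 1) (cyclotomicLevelsRat p (badPlaces c d A N)).idealOne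
  rw [hx₂, hco, hx₁] at hT
  simp only [Algebra.TensorProduct.map_tmul, AlgHom.coe_id, id_eq] at hT
  rw [← TensorProduct.tmul_sum] at hT
  exact (tmul_right_injective _ hT).symm

/-! ## §5 The depleted `L`-value and the cusp factor do not see the level; (D5); the descent theorem -/

omit hp in
/-- Coprimality to `M₁` and to `M₂` agree when `M₁`, `M₂` have the same prime divisors. [folklore] -/
private theorem coprime_iff_of_primes {k M₁ M₂ : ℕ} (hrad : ∀ q : ℕ, q.Prime → (q ∣ M₁ ↔ q ∣ M₂)) :
    k.Coprime M₁ ↔ k.Coprime M₂ := by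
  constructor
  · intro h
    refine Nat.coprime_of_dvd fun q hq hqk hq₂ => ?_
    have h1 : q ∣ Nat.gcd k M₁ := Nat.dvd_gcd hqk ((hrad q hq).mpr hq₂)
    rw [h.gcd_eq_one] at h1
    exact hq.ne_one (Nat.dvd_one.mp h1)
  · intro h
    refine Nat.coprime_of_dvd fun q hq hqk hq₁ => ?_
    have h1 : q ∣ Nat.gcd k M₂ := Nat.dvd_gcd hqk ((hrad q hq).mp hq₁)
    rw [h.gcd_eq_one] at h1
    exact hq.ne_one (Nat.dvd_one.mp h1)

omit hp in
/-- Induced characters to moduli with the same prime divisors take the same values on `ℕ`. [folklore] -/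
private theorem changeLevel_natCast_eq {m M₁ M₂ : ℕ} [NeZero M₁] [NeZero M₂] (χ : DirichletCharacter ℂ m)
    (h₁ : m ∣ M₁) (h₂ : m ∣ M₂) (hrad : ∀ q : ℕ, q.Prime → (q ∣ M₁ ↔ q ∣ M₂)) (k : ℕ) :
    DirichletCharacter.changeLevel h₁ χ (k : ZMod M₁) = DirichletCharacter.changeLevel h₂ χ (k : ZMod M₂) := by
  by_cases hk : k.Coprime M₁
  · have hk₂ : k.Coprime M₂ := (coprime_iff_of_primes hrad).mp hk
    have e₁ := DirichletCharacter.changeLevel_eq_cast_of_dvd' χ h₁ (a := k) (Nat.isCoprime_iff_coprime.mpr hk)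
    have e₂ := DirichletCharacter.changeLevel_eq_cast_of_dvd' χ h₂ (a := k) (Nat.isCoprime_iff_coprime.mpr hk₂)
    simp only [Int.cast_natCast] at e₁ e₂
    rw [e₁, e₂]
  · have hk₂ : ¬ k.Coprime M₂ := fun h => hk ((coprime_iff_of_primes hrad).mpr h)
    rw [MulChar.map_nonunit _ (mt (ZMod.isUnit_iff_coprime k M₁).mp hk),
      MulChar.map_nonunit _ (mt (ZMod.isUnit_iff_coprime k M₂).mp hk₂)]

omit hp in
/-- The prime divisors of `p^{k+1}·(pA)` do not depend on `k`. [folklore] -/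
private theorem prime_dvd_level_mul_iff {A : ℕ} (k : ℕ) {q : ℕ} (hq : q.Prime) :
    q ∣ cycLevel p (k + 1) ∅ * (p * A) ↔ q ∣ p ∨ q ∣ A := by
  rw [cycLevel_empty, hq.dvd_mul, hq.dvd_mul]
  constructor
  · rintro (h | h | h)
    · exact Or.inl (hq.dvd_of_dvd_pow h)
    · exact Or.inl h
    · exact Or.inr h
  · rintro (h | h)
    · exact Or.inr (Or.inl h)
    · exact Or.inr (Or.inr h)

/-- **The depleted twisted series does not see the `p`-level**: a depleted continuation of `L_{(p^{n+1}·pA)}(f, χ, s)`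
IS a depleted continuation of `L_{(p^{n+2}·pA)}(f, χ∘π, s)` (same primes removed, same primitive character; Kato §6.2,
`S = prime(m·p·A)`). [cite: Kato2004Asterisque, §6.2 (p. 161)] -/
theorem isDepletedTwistedL_succ {N : ℕ} (f : CuspForm (Gamma0 N) 2) {n : ℕ} {A : ℕ} (hA : 0 < A)
    (χ : DirichletCharacter ℂ (cycLevel p (n + 1) ∅)) {L : ℂ → ℂ}
    (hL : IsDepletedTwistedL f (cycLevel p (n + 1) ∅) (p * A) χ L) :
    IsDepletedTwistedL f (cycLevel p (n + 2) ∅) (p * A)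
      (DirichletCharacter.changeLevel (show cycLevel p (n + 1) ∅ ∣ cycLevel p (n + 2) ∅ from
        mul_dvd_mul_right (pow_dvd_pow p (Nat.le_succ (n + 1))) _) χ) L := by
  haveI : NeZero (cycLevel p (n + 1) ∅ * (p * A)) :=
    ⟨mul_ne_zero (NeZero.ne _) (mul_ne_zero hp.out.ne_zero hA.ne')⟩
  haveI : NeZero (cycLevel p (n + 2) ∅ * (p * A)) :=
    ⟨mul_ne_zero (NeZero.ne _) (mul_ne_zero hp.out.ne_zero hA.ne')⟩
  refine ⟨hL.1, fun s hs => ?_⟩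
  rw [hL.2 s hs]
  unfold twistedLSeries
  congr 1
  funext k
  rw [← DirichletCharacter.changeLevel_trans]
  congr 1
  refine changeLevel_natCast_eq χ _ _ (fun q hq => ?_) k
  rw [prime_dvd_level_mul_iff n hq, prime_dvd_level_mul_iff (n + 1) hq]

omit hp in
/-- The cusp factor `R^∓_{χ̄}(c, d, a, A, d′)` only reads `χ̄` at `c`, `d`, `cd`. [cite: Kato2004Asterisque, Lemma 13.10 (1) (p. 230)] -/
theorem cuspFactor_congr {N : ℕ} (f : CuspForm (Gamma0 N) 2) (ev : Bool) {F G : ℤ → ℂ} (c d a : ℤ) (A : ℕ)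
    (d' : ℤ) (h1 : F c = G c) (h2 : F d = G d) (h3 : F (c * d) = G (c * d)) :
    cuspFactor f ev F c d a A d' = cuspFactor f ev G c d a A d' := by
  simp only [cuspFactor, h1, h2, h3]

/-- **(D5) The unit of (D1) in terms of the offsets**: if `ρ` is `ι`-standard at levels `n+1`, `n+2`, `μ = ρ^{o}` at both
levels and `j(μ_n) = μ_{n+1}^p`, then the unit `t` with `ι₂ ∘ j = ι₁ ∘ σ_t` is `t = π(o_{n+1}) · o_n⁻¹`
(`exp(2πi/p^{n+2})^p = exp(2πi/p^{n+1})`). [cite: Kato2004Asterisque, §4.2 (p. 143) and (5.7.1) (p. 157)] -/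
theorem unit_eq_unitsMap_mul_inv {n : ℕ} {ι₁ : CyclotomicField (cycLevel p (n + 1) ∅) ℚ →+* ℂ}
    {ι₂ : CyclotomicField (cycLevel p (n + 2) ∅) ℚ →+* ℂ}
    {j : CyclotomicField (cycLevel p (n + 1) ∅) ℚ →ₐ[ℚ] CyclotomicField (cycLevel p (n + 2) ∅) ℚ}
    {ρn μn : CyclotomicField (cycLevel p (n + 1) ∅) ℚ} {ρs μs : CyclotomicField (cycLevel p (n + 2) ∅) ℚ}
    (hρn : ι₁ ρn = Complex.exp (2 * Real.pi * Complex.I / (p ^ (n + 1) : ℂ)))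
    (hρs : ι₂ ρs = Complex.exp (2 * Real.pi * Complex.I / (p ^ (n + 1 + 1) : ℂ)))
    {o₁ : (ZMod (cycLevel p (n + 1) ∅))ˣ} {o₂ : (ZMod (cycLevel p (n + 2) ∅))ˣ}
    (hon : μn = ρn ^ ((o₁ : ZMod (cycLevel p (n + 1) ∅)).val))
    (hos : μs = ρs ^ ((o₂ : ZMod (cycLevel p (n + 2) ∅)).val)) (hj : j μn = μs ^ p)
    {t : (ZMod (cycLevel p (n + 1) ∅))ˣ}
    (ht : ∀ y : CyclotomicField (cycLevel p (n + 1) ∅) ℚ, ι₂ (j y) = ι₁ (sigma (cycLevel p (n + 1) ∅) t y)) :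
    t = ZMod.unitsMap (show cycLevel p (n + 1) ∅ ∣ cycLevel p (n + 2) ∅ from
        mul_dvd_mul_right (pow_dvd_pow p (Nat.le_succ (n + 1))) _) o₂ * o₁⁻¹ := by
  set hd : cycLevel p (n + 1) ∅ ∣ cycLevel p (n + 2) ∅ := mul_dvd_mul_right (pow_dvd_pow p (Nat.le_succ (n + 1))) _
  set ζ₁ : ℂ := Complex.exp (2 * Real.pi * Complex.I / (p ^ (n + 1) : ℂ)) with hζ₁
  have hζ₁prim : IsPrimitiveRoot ζ₁ (p ^ (n + 1)) := by
    have h' := Complex.isPrimitiveRoot_exp (p ^ (n + 1)) (pow_ne_zero _ hp.out.ne_zero)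
    rwa [Nat.cast_pow] at h'
  have hζ₁one : ζ₁ ^ (cycLevel p (n + 1) ∅) = 1 := by rw [cycLevel_empty]; exact hζ₁prim.pow_eq_one
  have hζ₂p : Complex.exp (2 * Real.pi * Complex.I / (p ^ (n + 1 + 1) : ℂ)) ^ p = ζ₁ := by
    rw [hζ₁, ← Complex.exp_nat_mul]
    congr 1
    have hp0 : (p : ℂ) ≠ 0 := Nat.cast_ne_zero.mpr hp.out.ne_zero
    field_simp
    ring
  have hζ₁prim' : IsPrimitiveRoot ζ₁ (cycLevel p (n + 1) ∅) := by
    rw [cycLevel_empty]; exact hζ₁prim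
  have hρn1 : ρn ^ (cycLevel p (n + 1) ∅) = 1 :=
    ((congrArg (IsPrimitiveRoot ρn) (cycLevel_empty (p := p) (n + 1))).mpr
      (isPrimitiveRoot_of_apply_eq_exp hρn)).pow_eq_one
  have hμn1 : μn ^ (cycLevel p (n + 1) ∅) = 1 := by
    rw [hon, pow_right_comm, hρn1, one_pow]
  -- evaluate `ι₂ (j μn)` in two ways
  have h1 : ι₂ (j μn) = ζ₁ ^ ((o₂ : ZMod (cycLevel p (n + 2) ∅)).val) := by
    rw [hj, map_pow, hos, map_pow, hρs, pow_right_comm, hζ₂p]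
  have h2 : ι₂ (j μn) = ζ₁ ^ (((o₁ : ZMod (cycLevel p (n + 1) ∅)).val) * ((t : ZMod (cycLevel p (n + 1) ∅)).val)) := by
    rw [ht, sigma_apply_of_pow_eq_one _ t μn hμn1, map_pow, hon, map_pow, hρn, pow_mul]
  have hmod : ((o₂ : ZMod (cycLevel p (n + 2) ∅)).val) % cycLevel p (n + 1) ∅ =
      (((o₁ : ZMod (cycLevel p (n + 1) ∅)).val) * ((t : ZMod (cycLevel p (n + 1) ∅)).val)) % cycLevel p (n + 1) ∅ := by
    have h12 := h1.symm.trans h2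
    rw [pow_eq_pow_mod hζ₁one ((o₂ : ZMod (cycLevel p (n + 2) ∅)).val),
      pow_eq_pow_mod hζ₁one (_ * _)] at h12
    exact hζ₁prim'.pow_inj (Nat.mod_lt _ (NeZero.pos _)) (Nat.mod_lt _ (NeZero.pos _)) h12
  have hunits : ZMod.unitsMap hd o₂ = o₁ * t := by
    apply Units.ext
    have e1 : ((ZMod.unitsMap hd o₂ : (ZMod (cycLevel p (n + 1) ∅))ˣ) : ZMod (cycLevel p (n + 1) ∅)) =
        (((o₂ : ZMod (cycLevel p (n + 2) ∅)).val : ℕ) : ZMod (cycLevel p (n + 1) ∅)) := by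
      rw [ZMod.unitsMap_val, ZMod.cast_eq_val]
    have e2 : ((o₁ * t : (ZMod (cycLevel p (n + 1) ∅))ˣ) : ZMod (cycLevel p (n + 1) ∅)) =
        (((o₁ : ZMod (cycLevel p (n + 1) ∅)).val * (t : ZMod (cycLevel p (n + 1) ∅)).val : ℕ) :
          ZMod (cycLevel p (n + 1) ∅)) := by
      rw [Units.val_mul, Nat.cast_mul, ZMod.natCast_zmod_val, ZMod.natCast_zmod_val]
    rw [e1, e2]
    exact (ZMod.natCast_eq_natCast_iff' _ _ _).mpr hmod
  rw [hunits, mul_comm o₁ t, mul_inv_cancel_right]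

set_option maxHeartbeats 800000 in
/-- **FRAME-OFFSET DESCENT (the theorem).** Let `W/ℚ` be an elliptic curve, `p` an odd prime, `f` the newform of `W`, and
let `(z, x)` be a Kato zeta family for `T_pW` with values in the frame `(ι, Λ)`, `Kato2004.ZetaBody W p f ι κK Λ c d a A z x`
((C1) Prop. 8.12 / (13.1.1); (C4) Thm. 9.7; (C5) Thm. 9.7 ∘ Thm. 6.6 (1)), with `κK ≠ 0` and Kato's guards `A ≥ 1`,
`(c, 6pA) = 1`, `(d, 6pN) = 1`, `dd′ ≡ 1 (A)`, `R⁻_𝟙(c,d,a,A,d′) ≠ 0` (Ex. 13.3).  Assume Rohrlich's theorem for `f` in the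
shape `hR` (finitely many primitive `χ` of `p`-power conductor with `L(f, χ, 1) = 0`; the tree theorem
`PSRohrlichAtLevel.rohrlich_primePow_of_isNewformOf` discharges it).  Let `μ` be a root system TRACE-COHERENT with `Λ`
(`Kato2004.IsTraceCoherentRootSystem`), `ρ` the `ι`-standard root system (`ι(ρ_n) = exp(2πi/p^{n+1})`) and `o_n` the offsets,
`μ_n = ρ_n^{o_n}`.  THEN there is `n₁` such that for all `n ≥ n₁` the cross-level offset `π(o_{n+1}) · o_n⁻¹ ∈ (ℤ/p^{n+1})ˣ`
is TAME: `(π(o_{n+1}) · o_n⁻¹)^{p−1} = 1`.  (Proof: (D1)–(D5) of the module docstring: the value law read at the layer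
character of level `p^{n+1}` in the two frames `ι_{n+2} ∘ j_n` and `ι_{n+1}` forces `χ(t_n) = 1` once `L(f,χ,1)·R⁻_χ̄ ≠ 0`,
which Rohrlich + `LayerCharacter.exists_layerCharacter_cuspFactor_ne_zero` grant beyond `n₁`.)  In print: Kato's root system
`ζ_{p^n} = exp(2πi/p^n)` (§4.2) is norm-coherent and the zeta elements are norm-compatible in it (Prop. 8.12), so [C-align]'s
`μ` may be taken `ι`-standard; the kernel recovers this from the values alone, beyond `n₁`.
[cite: Kato2004Asterisque, §4.2 (p. 143), Thm. 6.6 (1) (p. 163), Prop. 8.12 (p. 186), Thm. 9.7 (p. 189), Thm. 12.5 (1) and proof (pp. 221–222), Ex. 13.3 (p. 225)]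
[cite: RohrlichInventiones1984, Theorem (p. 409)] [cite: Kobayashi2003, §8.4 (p. 16)] -/
theorem exists_forall_offset_pow_sub_one_eq_one
    {W : WeierstrassCurve ℚ} [W.IsElliptic] [ContinuousSMul ℤ_[p] (W.tateModule p)]
    [Module.Free ℤ_[p] (W.tateModule p)] [Module.Finite ℤ_[p] (W.tateModule p)]
    (hp2 : p ≠ 2) {N : ℕ} [NeZero N] {f : CuspForm (Gamma0 N) 2} (hf : IsNewformOf W f)
    {ι : (m : ℕ) → (CyclotomicField m ℚ →+* ℂ)} {κK : ℝ} (hκK : κK ≠ 0)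
    {Λ : ∀ (k : ℕ) (r : Finset (HeightOneSpectrum (𝓞 ℚ))),
      H1 (tateRep W p) (cycSubgroup p k r) →ₗ[ℤ_[p]] ℚ_[p] ⊗[ℚ] CyclotomicField (cycLevel p k r) ℚ}
    {c d a : ℤ} {A : ℕ} {d' : ℤ} (hA : 0 < A) (hc : Int.gcd c (6 * p * A) = 1)
    (hd : Int.gcd d (6 * p * N) = 1) (hdd' : d * d' ≡ 1 [ZMOD (A : ℤ)])
    (hRne : ratCuspFactor f true c d a A d' ≠ 0)
    {z : ∀ (k : ℕ) (r : (cyclotomicLevelsRat p (badPlaces c d A N)).Ideals),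
      H1 (tateRep W p) ((cyclotomicLevelsRat p (badPlaces c d A N)).level k r.1)}
    {x : ∀ (k : ℕ) (r : (cyclotomicLevelsRat p (badPlaces c d A N)).Ideals), CyclotomicField (cycLevel p k r.1) ℚ}
    (hzeta : ZetaBody W p f ι κK Λ c d a A z x)
    (hR : Set.Finite {χ : Σ m : ℕ, DirichletCharacter ℂ m |
        χ.1 ≠ 0 ∧ χ.1.primeFactors ⊆ {p} ∧ χ.2.IsPrimitive ∧
          ∃ L : ℂ → ℂ, Differentiable ℂ L ∧ (∀ s : ℂ, 2 < s.re → L s = twistedLSeries f χ.2 s) ∧ L 1 = 0})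
    {μ : ∀ n : ℕ, CyclotomicField (cycLevel p (n + 1) ∅) ℚ} (hμ : IsTraceCoherentRootSystem W p Λ μ)
    {ρ : ∀ n : ℕ, CyclotomicField (cycLevel p (n + 1) ∅) ℚ}
    (hρ : ∀ n, ι (cycLevel p (n + 1) ∅) (ρ n) = Complex.exp (2 * Real.pi * Complex.I / (p ^ (n + 1) : ℂ)))
    {o : ∀ n : ℕ, (ZMod (cycLevel p (n + 1) ∅))ˣ}
    (ho : ∀ n, μ n = ρ n ^ ((o n : ZMod (cycLevel p (n + 1) ∅)).val)) :
    ∃ n₁ : ℕ, ∀ n : ℕ, n₁ ≤ n →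
      (ZMod.unitsMap (show cycLevel p (n + 1) ∅ ∣ cycLevel p (n + 2) ∅ from
          mul_dvd_mul_right (pow_dvd_pow p (Nat.le_succ (n + 1))) _) (o (n + 1)) * (o n)⁻¹) ^ (p - 1) = 1 := by
  classical
  -- (D4) inputs: layer characters with `R⁻ ≠ 0` beyond `n₀`; Rohrlich's bound `B`
  obtain ⟨n₀, hn₀⟩ := LayerCharacter.exists_layerCharacter_cuspFactor_ne_zero f hp2
    (natAbs_coprime_of_gcd_six_mul_eq_one hc) (natAbs_coprime_of_gcd_six_mul_eq_one hd) a A d' hRne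
  obtain ⟨B, hB⟩ := (hR.image Sigma.fst).bddAbove
  have hΩ : (plusPeriod f : ℂ) ≠ 0 :=
    Complex.ofReal_ne_zero.mpr (IsNewform0.plusPeriod_pos_holds hf.1 hf.coeffField_eq_bot_of_isNewformOf).ne'
  have hρprim : ∀ k, IsPrimitiveRoot (ρ k) (p ^ (k + 1)) := fun k => isPrimitiveRoot_of_apply_eq_exp (hρ k)
  refine ⟨n₀ + B + 1, fun n hn => ?_⟩
  have hdvd : cycLevel p (n + 1) ∅ ∣ cycLevel p (n + 2) ∅ := mul_dvd_mul_right (pow_dvd_pow p (Nat.le_succ (n + 1))) _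
  have hM : cycLevel p (n + 1) ∅ = p ^ (n + 1) := cycLevel_empty (n + 1)
  obtain ⟨χ, hker, hcusp⟩ := hn₀ n (by omega) (M := cycLevel p (n + 1) ∅) hM
  have heven : χ (-1) = 1 := LayerCharacter.apply_neg_one hp2 hker
  have hprim : χ.IsPrimitive := LayerCharacter.isPrimitive (by omega : 1 ≤ n) hM hker
  -- Shimura's continuation; Rohrlich off the exceptional levels
  obtain ⟨L₀, hL₀d, hL₀s⟩ := exists_differentiable_eq_twistedLSeries_holds f (m := cycLevel p (n + 1) ∅) χ
  have hL₀1 : L₀ 1 ≠ 0 := by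
    intro h0
    have hle : cycLevel p (n + 1) ∅ ≤ B := by
      refine hB ⟨⟨cycLevel p (n + 1) ∅, χ⟩, ?_, rfl⟩
      refine ⟨NeZero.ne _, ?_, hprim, L₀, hL₀d, hL₀s, h0⟩
      change (cycLevel p (n + 1) ∅).primeFactors ⊆ {p}
      rw [hM, Nat.primeFactors_prime_pow (Nat.succ_ne_zero _) hp.out]
    have hBn : B < p ^ (n + 1) := lt_of_lt_of_le (by omega) (Nat.lt_pow_self hp.out.one_lt).le
    rw [hM] at hle
    omega
  -- ONE depleted continuation, non-zero at `1`, serving both levels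
  haveI : NeZero (cycLevel p (n + 1) ∅ * (p * A)) :=
    ⟨mul_ne_zero (NeZero.ne _) (mul_ne_zero hp.out.ne_zero hA.ne')⟩
  obtain ⟨Lχ, hLd, hLs, hL1⟩ := exists_continuation_changeLevel_of hf
    (dvd_mul_right (cycLevel p (n + 1) ∅) (p * A)) χ ⟨L₀, hL₀d, hL₀s, hL₀1⟩
  have hdep₁ : IsDepletedTwistedL f (cycLevel p (n + 1) ∅) (p * A) χ Lχ := ⟨hLd, hLs⟩
  have hdep₂ := isDepletedTwistedL_succ f hA χ hdep₁
  -- (C5) in the two frames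
  have hgcd₁ := gcd_mul_cycLevel_mul_eq_one_of_guards (p := p) hc hd hdd' n
  have hgcd₂ := gcd_mul_cycLevel_mul_eq_one_of_guards (p := p) hc hd hdd' (n + 1)
  have hv₁ : charSum (cycLevel p (n + 1) ∅) (ι (cycLevel p (n + 1) ∅)) χ (x (n + 1) (cyclotomicLevelsRat p (badPlaces c d A N)).idealOne) =
      (κK : ℂ) * (Lχ 1 / (plusPeriod f : ℂ)) *
        cuspFactor f true (fun k ↦ χ⁻¹ (k : ZMod (cycLevel p (n + 1) ∅))) c d a A d' :=
    (hzeta.2.2.2.2.2 (n + 1) (cyclotomicLevelsRat p (badPlaces c d A N)).idealOne d' χ Lχ hgcd₁ hdd' hdep₁).1 heven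
  have heven₂ : DirichletCharacter.changeLevel hdvd χ (-1) = 1 := by
    have h := DirichletCharacter.changeLevel_eq_cast_of_dvd' χ hdvd (a := -1)
      (Int.isCoprime_iff_gcd_eq_one.mpr (by simp))
    push_cast at h
    rw [h, heven]
  have hv₂ : charSum (cycLevel p (n + 2) ∅) (ι (cycLevel p (n + 2) ∅)) (DirichletCharacter.changeLevel hdvd χ)
      (x (n + 2) (cyclotomicLevelsRat p (badPlaces c d A N)).idealOne) =
      (κK : ℂ) * (Lχ 1 / (plusPeriod f : ℂ)) *
        cuspFactor f true (fun k ↦ (DirichletCharacter.changeLevel hdvd χ)⁻¹ (k : ZMod (cycLevel p (n + 2) ∅)))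
          c d a A d' :=
    (hzeta.2.2.2.2.2 (n + 2) (cyclotomicLevelsRat p (badPlaces c d A N)).idealOne d'
      (DirichletCharacter.changeLevel hdvd χ) Lχ hgcd₂ hdd' hdep₂).1 heven₂
  -- the two cusp factors agree (`c`, `d`, `cd` are prime to `p`)
  have hcp : IsCoprime c (p : ℤ) :=
    ((Int.isCoprime_iff_gcd_eq_one.mpr hc).of_mul_right_left).of_mul_right_right
  have hdp : IsCoprime d (p : ℤ) :=
    ((Int.isCoprime_iff_gcd_eq_one.mpr hd).of_mul_right_left).of_mul_right_right
  have hm₂ : (cycLevel p (n + 2) ∅ : ℤ) = (p : ℤ) ^ (n + 2) := by rw [cycLevel_empty]; push_cast; rfl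
  have hval : ∀ k : ℤ, IsCoprime k (p : ℤ) →
      (DirichletCharacter.changeLevel hdvd χ)⁻¹ (k : ZMod (cycLevel p (n + 2) ∅)) =
        χ⁻¹ (k : ZMod (cycLevel p (n + 1) ∅)) := by
    intro k hk
    rw [← map_inv]
    exact DirichletCharacter.changeLevel_eq_cast_of_dvd' χ⁻¹ hdvd (by rw [hm₂]; exact hk.pow_right)
  have hcuspeq : cuspFactor f true
        (fun k ↦ (DirichletCharacter.changeLevel hdvd χ)⁻¹ (k : ZMod (cycLevel p (n + 2) ∅))) c d a A d' =
      cuspFactor f true (fun k ↦ χ⁻¹ (k : ZMod (cycLevel p (n + 1) ∅))) c d a A d' :=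
    cuspFactor_congr f true c d a A d' (hval c hcp) (hval d hdp) (hval (c * d) (hcp.mul_left hdp))
  -- (D1), (D2), (D3)
  obtain ⟨j, hj⟩ := exists_algHom_apply_eq_pow (hμ.1 n) (hμ.1 (n + 1))
  obtain ⟨t, ht⟩ := exists_unit_comp_eq (ι (cycLevel p (n + 1) ∅)) (ι (cycLevel p (n + 2) ∅)) j (hρprim n)
  have hx := algHom_apply_eq_sum_sigma hzeta hμ n j hj
  have hcs := charSum_changeLevel_eq (ι (cycLevel p (n + 1) ∅)) (ι (cycLevel p (n + 2) ∅)) j (hμ.1 n)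
    (hμ.1 (n + 1)) hj ht hx χ
  -- `χ(t⁻¹) · V = V` with `V ≠ 0`
  have hV : (κK : ℂ) * (Lχ 1 / (plusPeriod f : ℂ)) *
      cuspFactor f true (fun k ↦ χ⁻¹ (k : ZMod (cycLevel p (n + 1) ∅))) c d a A d' ≠ 0 :=
    mul_ne_zero (mul_ne_zero (Complex.ofReal_ne_zero.mpr hκK) (div_ne_zero hL1 hΩ)) hcusp
  rw [hv₂, hcuspeq, hv₁] at hcs
  have hχtinv : χ ((t⁻¹ : (ZMod (cycLevel p (n + 1) ∅))ˣ) : ZMod (cycLevel p (n + 1) ∅)) = 1 :=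
    (mul_eq_right₀ hV).mp hcs.symm
  have hχt : χ (t : ZMod (cycLevel p (n + 1) ∅)) = 1 := by
    have h : χ ((t⁻¹ : (ZMod (cycLevel p (n + 1) ∅))ˣ) : ZMod (cycLevel p (n + 1) ∅)) *
        χ (t : ZMod (cycLevel p (n + 1) ∅)) = 1 := by
      rw [← map_mul, ← Units.val_mul, inv_mul_cancel, Units.val_one, map_one]
    rwa [hχtinv, one_mul] at h
  -- (D5) and the kernel of the layer character
  have ht' := unit_eq_unitsMap_mul_inv (hρ n) (hρ (n + 1)) (ho n) (ho (n + 1)) hj ht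
  rw [← ht']
  exact (hker t).mp hχt

/-- **Corollary: the wild offsets are COHERENT beyond `n₁`** — `π(o_{n+1})^{p^{n+1}−1} = o_n^{pⁿ−1}` in `(ℤ/p^{n+1})ˣ` for
`n ≥ n₁` (`x ↦ x^{pⁿ−1}` kills the torsion `μ_{p−1}` and inverts the wild part; `#(ℤ/p^{n+1})ˣ = pⁿ(p−1)`), i.e. the family
`(o_n^{pⁿ−1})_{n ≥ n₁}` is ONE element of `lim (ℤ/p^{n+1})ˣ = ℤ_pˣ`. [cite: Kato2004Asterisque, §4.2 (p. 143), Prop. 8.12 (p. 186)]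
[cite: Washington1997, §13.1] -/
theorem unitsMap_pow_eq_pow_of_tame {n : ℕ} {o₁ : (ZMod (cycLevel p (n + 1) ∅))ˣ}
    {o₂ : (ZMod (cycLevel p (n + 2) ∅))ˣ}
    (h : (ZMod.unitsMap (show cycLevel p (n + 1) ∅ ∣ cycLevel p (n + 2) ∅ from
        mul_dvd_mul_right (pow_dvd_pow p (Nat.le_succ (n + 1))) _) o₂ * o₁⁻¹) ^ (p - 1) = 1) :
    ZMod.unitsMap (show cycLevel p (n + 1) ∅ ∣ cycLevel p (n + 2) ∅ from
        mul_dvd_mul_right (pow_dvd_pow p (Nat.le_succ (n + 1))) _) o₂ ^ (p ^ (n + 1) - 1) = o₁ ^ (p ^ n - 1) := by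
  set hd : cycLevel p (n + 1) ∅ ∣ cycLevel p (n + 2) ∅ := mul_dvd_mul_right (pow_dvd_pow p (Nat.le_succ (n + 1))) _
  set t := ZMod.unitsMap hd o₂ * o₁⁻¹ with htdef
  have hπ : ZMod.unitsMap hd o₂ = t * o₁ := by rw [htdef, inv_mul_cancel_right]
  -- `t^{p^{n+1} − 1} = 1`
  obtain ⟨q, hq⟩ : (p - 1) ∣ (p ^ (n + 1) - 1) := Nat.sub_one_dvd_pow_sub_one p (n + 1)
  have ht1 : t ^ (p ^ (n + 1) - 1) = 1 := by rw [hq, pow_mul, h, one_pow]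
  -- `o₁^{p^{n+1} − p^n} = 1` (order of the unit group)
  have hcard : Fintype.card (ZMod (cycLevel p (n + 1) ∅))ˣ = p ^ n * (p - 1) := by
    rw [ZMod.card_units_eq_totient, cycLevel_empty, Nat.totient_prime_pow hp.out (Nat.succ_pos n),
      Nat.succ_sub_one]
  have hon1 : o₁ ^ (p ^ n * (p - 1)) = 1 := by rw [← hcard]; exact pow_card_eq_one
  have hexp : p ^ (n + 1) - 1 = p ^ n * (p - 1) + (p ^ n - 1) := by
    have h1 : 1 ≤ p ^ n := Nat.one_le_pow _ _ hp.out.pos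
    have h2 : p ^ n * (p - 1) = p ^ (n + 1) - p ^ n := by
      rw [Nat.mul_sub_one, pow_succ, mul_comm]
    have h3 : p ^ n ≤ p ^ (n + 1) := Nat.pow_le_pow_right hp.out.pos (Nat.le_succ n)
    omega
  rw [hπ, mul_pow, ht1, one_mul, hexp, pow_add, hon1, one_mul]

end FrameOffsetDescent

end Literature.NumberTheory.EllipticCurves.Kato2004

end
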